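import Literature.Probability.RandomPlanarGeometry.HullSubdomainPullback
import Literature.Probability.RandomPlanarGeometry.ConformalRectangle
import Literature.Probability.RandomPlanarGeometry.RestrictionHulls
import Literature.Probability.RandomPlanarGeometry.HexParafermion
import Literature.Probability.RandomPlanarGeometry.HexSAW
import HarnessLib

/-!
# Crux `SAWDevelopingMap.ObservableToSLE` (stmt-CriticalPhenomena-10472), line
`floor-ratio-restriction-bootstrap`: boundary insensitivity from the admissible cocycle

Landing target:
`Summits/CriticalPhenomena/SAWScalingLimit/Theorems/SAWDevelopingMapObservableToSLECanonicalTransferInsensitivity.lean`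
(`--supports stmt-CriticalPhenomena-10472`).

The hypothesis of the registered stub `stub_canonicalTransfer` (the ADMISSIBLE RESTRICTION LIMIT:
`Z_{Λ'δ}(a,b)/Z_{Λδ}(a,b) → Φ'_A(0)^{5/8}` for nested admissible vertex-domain families
`Λ' δ ⊆ Λ δ` discretising a hull subdomain `D' ⊆ D` of a floor domain) contains, at `D' = D`
(`A = ∅`, `Φ_∅ = id`, `Φ'_∅(0) = 1`), the **boundary-insensitivity principle**: ANY two nested
admissible discretisations of the same floor domain have asymptotically equal critical partition
functions, `Z_{Λ'δ}/Z_{Λδ} → 1`.  This is the mechanism by which the transfer to the canonical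
law absorbs the difference between the canonical domain `Ω_δ` of `HexSAW.lean` and an admissible
family (pendant rows, boundary collars, bad edges), once the canonical critical mass is
sandwiched between two admissible families (`…CanonicalTransferSandwich.lean`).

* `pullbackHull_self` — the pulled-back hull of `D` itself is empty;
* `isRestrictionMap_self`, `hasRestrictionDeriv_self` — the identity of `ℍ`, transported to
  `ℍ ∖ A_D`, is the restriction map of the empty hull with `Φ'(0) = 1`;
* `stub_canonicalTransfer_insensitivity` — the registered sub-goal: the admissible restriction
  limit implies `Z_{Λ'δ}/Z_{Λδ} → 1` for nested admissible families of one floor domain.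
-/

noncomputable section

open scoped BigOperators Topology
open Filter Set Metric
open Literature.Probability.LatticeModels (HexVertex hexGraph hexCenter)
open Literature.Probability.RandomPlanarGeometry
open Literature.Probability.RandomPlanarGeometry.SAW
open UpperHalfPlane (upperHalfPlaneSet)

namespace Summit.CriticalPhenomena.SAWScalingLimit.Theorems.ObservableToSLE.FloorRatio

/-! ### The trivial hull subdomain `D' = D` -/

section SelfHull

variable {D : DobrushinDomain} (φ : ConformalEquiv upperHalfPlaneSet D.carrier)

/-- `φ⁻¹(D) = ℍ`: every point of the half-plane is mapped into `D`. [folklore] -/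
theorem pullbackDomain_self : φ.pullbackDomain D = upperHalfPlaneSet :=
  Set.ext fun _ => ⟨fun hz => hz.1, fun hz => ⟨hz, φ.mapsTo hz⟩⟩

/-- **The pulled-back hull of `D` itself is empty** (`A = closure (ℍ ∖ ℍ) = ∅`). [folklore] -/
theorem pullbackHull_self : φ.pullbackHull D = ∅ := by
  rw [ConformalEquiv.pullbackHull, pullbackDomain_self, sdiff_self]
  exact closure_empty

/-- `ℍ ∖ A_D = ℍ ∖ ∅` for the (empty) pulled-back hull of `D` itself. [folklore] -/
theorem diff_pullbackHull_self :
    upperHalfPlaneSet \ φ.pullbackHull D = upperHalfPlaneSet \ (∅ : Set ℂ) := by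
  rw [pullbackHull_self]

/-- The identity, viewed as a map `ℍ ∖ A_D → ℍ`, is the restriction map `Φ_∅` of the (empty)
pulled-back hull of `D` itself. [cite: LawlerSchrammWerner2003Restriction, §2 p. 8 (Φ_A)] -/
theorem isRestrictionMap_self :
    IsRestrictionMap (φ.pullbackHull D)
      (restrictionMapEmpty.copy _ _ (diff_pullbackHull_self φ) rfl) := by
  refine ⟨?_, ?_⟩
  · change Tendsto (fun z : ℂ => restrictionMapEmpty.copy _ _ (diff_pullbackHull_self φ) rfl z) _ _
    simp only [ConformalEquiv.copy_apply, restrictionMapEmpty_apply]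
    exact tendsto_id.mono_left nhdsWithin_le_nhds
  · simp only [ConformalEquiv.copy_apply, restrictionMapEmpty_apply]
    have h : {z : ℂ | z ≠ 0} ∈ cocompact ℂ ⊓ 𝓟 (upperHalfPlaneSet \ φ.pullbackHull D) :=
      mem_inf_of_left (isCompact_singleton (x := (0 : ℂ))).compl_mem_cocompact
    refine (tendsto_const_nhds (x := (1 : ℂ))).congr' ?_
    filter_upwards [h] with z hz
    rw [div_self hz]

/-- … and its number `Φ'(0)` is `1`. [cite: LawlerSchrammWerner2003Restriction, (2.4) p. 7] -/
theorem hasRestrictionDeriv_self :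
    HasRestrictionDeriv (φ.pullbackHull D)
      (restrictionMapEmpty.copy _ _ (diff_pullbackHull_self φ) rfl) 1 := by
  unfold HasRestrictionDeriv
  simp only [ConformalEquiv.copy_apply, restrictionMapEmpty_apply]
  refine (tendsto_const_nhds (x := ((1 : ℝ) : ℂ))).congr' ?_
  filter_upwards [self_mem_nhdsWithin] with z hz
  have hz0 : z ≠ 0 := by
    rintro rfl
    exact absurd hz.1 (by simp [upperHalfPlaneSet])
  rw [Complex.ofReal_one, div_self hz0]

end SelfHull

/-! ### Registered form: boundary insensitivity (sub-goal of `stub_canonicalTransfer`) -/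

/-- **Registered sub-goal `stub_canonicalTransfer_insensitivity`** (crux item
stmt-CriticalPhenomena-10472, line `floor-ratio-restriction-bootstrap`, stub
`stub_canonicalTransfer`): the hypothesis of `stub_canonicalTransfer` (admissible restriction
limit, verbatim) implies the BOUNDARY-INSENSITIVITY PRINCIPLE — for a floor domain `D` with a
chordal uniformizer and any two nested admissible discretising families `Λ' δ ⊆ Λ δ` of `D` itself
(both simply connected and connected, exact half-lattice rows near the marked points, exhausting
the compacts of `D`, common floor mid-edge endpoints converging to the marked points),
`Z_{Λ'δ}(a δ, b δ) / Z_{Λδ}(a δ, b δ) → 1`: the case `D' = D`, `A = ∅`, `Φ = id`, `Φ'(0) = 1`.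
[cite: LawlerSchrammWerner2004SAW, §3.4 ("SAW satisfies restriction")] -/
theorem stub_canonicalTransfer_insensitivity :
    (∀ (D D' : DobrushinDomain) (ρ : ℝ) (φ : ConformalEquiv upperHalfPlaneSet D.carrier)
    (Φ : ConformalEquiv (upperHalfPlaneSet \ φ.pullbackHull D') upperHalfPlaneSet) (d : ℝ)
    (Λ Λ' : ℝ → Finset HexVertex) (m : ℝ → ℤ) (a b : ℝ → Sym2 HexVertex),
    (0 < ρ ∧ (D.pt 1).im = (D.pt 0).im ∧ D.carrier ⊆ {z : ℂ | (D.pt 0).im < z.im} ∧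
    D.carrier ∩ ball (D.pt 0) ρ = {z : ℂ | (D.pt 0).im < z.im} ∩ ball (D.pt 0) ρ ∧
    D.carrier ∩ ball (D.pt 1) ρ = {z : ℂ | (D.pt 1).im < z.im} ∩ ball (D.pt 1) ρ) →
    D.IsHullSubdomain D' → D.IsChordalUniformizing φ →
    IsRestrictionMap (φ.pullbackHull D') Φ → HasRestrictionDeriv (φ.pullbackHull D') Φ d →
    (∀ᶠ δ : ℝ in 𝓝[>] 0,
    Λ' δ ⊆ Λ δ ∧ hexDomainSimplyConnected (Λ δ) ∧ hexDomainSimplyConnected (Λ' δ) ∧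
    (hexGraph.induce (↑(Λ δ) : Set HexVertex)).Preconnected ∧
    (hexGraph.induce (↑(Λ' δ) : Set HexVertex)).Preconnected ∧
    a δ ∈ hexDomainBoundary (Λ δ) ∧ b δ ∈ hexDomainBoundary (Λ δ) ∧
    a δ ∈ hexDomainBoundary (Λ' δ) ∧ b δ ∈ hexDomainBoundary (Λ' δ) ∧
    Nonempty (HexMidEdgeSAW (Λ' δ) (a δ) (b δ)) ∧
    (∀ v ∈ Λ δ, (δ : ℂ) * hexCenter v ∈ D.carrier ∧ m δ ≤ v.1 1) ∧
    (∀ v ∈ Λ' δ, (δ : ℂ) * hexCenter v ∈ D'.carrier) ∧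
    (∀ v : HexVertex, (δ : ℂ) * hexCenter v ∈ ball (D.pt 0) ρ ∪ ball (D.pt 1) ρ →
    ((v ∈ Λ δ ↔ m δ ≤ v.1 1) ∧ (v ∈ Λ' δ ↔ m δ ≤ v.1 1)))) →
    (∀ K : Set ℂ, IsCompact K → K ⊆ D.carrier →
    ∀ᶠ δ : ℝ in 𝓝[>] 0, ∀ v : HexVertex, (δ : ℂ) * hexCenter v ∈ K → v ∈ Λ δ) →
    (∀ K : Set ℂ, IsCompact K → K ⊆ D'.carrier →
    ∀ᶠ δ : ℝ in 𝓝[>] 0, ∀ v : HexVertex, (δ : ℂ) * hexCenter v ∈ K → v ∈ Λ' δ) →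
    Tendsto (fun δ : ℝ => (δ : ℂ) * hexMidpoint (a δ)) (𝓝[>] 0) (𝓝 (D.pt 0)) →
    Tendsto (fun δ : ℝ => (δ : ℂ) * hexMidpoint (b δ)) (𝓝[>] 0) (𝓝 (D.pt 1)) →
    Tendsto (fun δ : ℝ => (∑ γ : HexMidEdgeSAW (Λ' δ) (a δ) (b δ), hexCriticalFugacity ^ γ.length) /
    (∑ γ : HexMidEdgeSAW (Λ δ) (a δ) (b δ), hexCriticalFugacity ^ γ.length)) (𝓝[>] 0)
    (𝓝 (d ^ ((5 : ℝ) / 8)))) →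
  ∀ (D : DobrushinDomain) (ρ : ℝ) (φ : ConformalEquiv upperHalfPlaneSet D.carrier)
  (Λ Λ' : ℝ → Finset HexVertex) (m : ℝ → ℤ) (a b : ℝ → Sym2 HexVertex),
  (0 < ρ ∧ (D.pt 1).im = (D.pt 0).im ∧ D.carrier ⊆ {z : ℂ | (D.pt 0).im < z.im} ∧
  D.carrier ∩ ball (D.pt 0) ρ = {z : ℂ | (D.pt 0).im < z.im} ∩ ball (D.pt 0) ρ ∧
  D.carrier ∩ ball (D.pt 1) ρ = {z : ℂ | (D.pt 1).im < z.im} ∩ ball (D.pt 1) ρ) →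
  D.IsChordalUniformizing φ →
  (∀ᶠ δ : ℝ in 𝓝[>] 0,
  Λ' δ ⊆ Λ δ ∧ hexDomainSimplyConnected (Λ δ) ∧ hexDomainSimplyConnected (Λ' δ) ∧
  (hexGraph.induce (↑(Λ δ) : Set HexVertex)).Preconnected ∧
  (hexGraph.induce (↑(Λ' δ) : Set HexVertex)).Preconnected ∧
  a δ ∈ hexDomainBoundary (Λ δ) ∧ b δ ∈ hexDomainBoundary (Λ δ) ∧
  a δ ∈ hexDomainBoundary (Λ' δ) ∧ b δ ∈ hexDomainBoundary (Λ' δ) ∧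
  Nonempty (HexMidEdgeSAW (Λ' δ) (a δ) (b δ)) ∧
  (∀ v ∈ Λ δ, (δ : ℂ) * hexCenter v ∈ D.carrier ∧ m δ ≤ v.1 1) ∧
  (∀ v ∈ Λ' δ, (δ : ℂ) * hexCenter v ∈ D.carrier) ∧
  (∀ v : HexVertex, (δ : ℂ) * hexCenter v ∈ ball (D.pt 0) ρ ∪ ball (D.pt 1) ρ →
  ((v ∈ Λ δ ↔ m δ ≤ v.1 1) ∧ (v ∈ Λ' δ ↔ m δ ≤ v.1 1)))) →
  (∀ K : Set ℂ, IsCompact K → K ⊆ D.carrier →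
  ∀ᶠ δ : ℝ in 𝓝[>] 0, ∀ v : HexVertex, (δ : ℂ) * hexCenter v ∈ K → v ∈ Λ' δ) →
  Tendsto (fun δ : ℝ => (δ : ℂ) * hexMidpoint (a δ)) (𝓝[>] 0) (𝓝 (D.pt 0)) →
  Tendsto (fun δ : ℝ => (δ : ℂ) * hexMidpoint (b δ)) (𝓝[>] 0) (𝓝 (D.pt 1)) →
  Tendsto (fun δ : ℝ => (∑ γ : HexMidEdgeSAW (Λ' δ) (a δ) (b δ), hexCriticalFugacity ^ γ.length) /
  (∑ γ : HexMidEdgeSAW (Λ δ) (a δ) (b δ), hexCriticalFugacity ^ γ.length)) (𝓝[>] 0) (𝓝 1) := by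
  intro H D ρ φ Λ Λ' m a b hD hφ hadm hK' ha hb
  -- exhaustion of the compacts of `D` by `Λ` follows from that by `Λ' ⊆ Λ`
  have hK : ∀ K : Set ℂ, IsCompact K → K ⊆ D.carrier →
      ∀ᶠ δ : ℝ in 𝓝[>] 0, ∀ v : HexVertex, (δ : ℂ) * hexCenter v ∈ K → v ∈ Λ δ := by
    intro K hKc hKD
    filter_upwards [hK' K hKc hKD, hadm] with δ h1 h2 v hv
    exact h2.1 (h1 v hv)
  have h := H D D ρ φ (restrictionMapEmpty.copy _ _ (diff_pullbackHull_self φ) rfl) 1 Λ Λ' m a b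
    hD (MarkedDomain.isHullSubdomain_self D) hφ (isRestrictionMap_self φ)
    (hasRestrictionDeriv_self φ) hadm hK hK' ha hb
  rwa [Real.one_rpow] at h

end Summit.CriticalPhenomena.SAWScalingLimit.Theorems.ObservableToSLE.FloorRatio

end
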